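import Summits.Ventures.CertifiedManyBodySolver.Theorems.M3x2EdgeSplitSymReplayShardsC
import Summits.Ventures.CertifiedManyBodySolver.Theorems.M3x2EdgeSplitSymReplaySyntaxV
import HarnessLib

/-!
# SymReplay — sharded replay on the EXECUTED canonicaliser (`…SyntaxV`): `canonNFV`, `shardOKFastV` (T12d; hub-lb-sym-eng-3)

T12c's per-call fact `shardOKFast` runs T1's `canonTermA (flatSite (minCorner frame))`, measured unusable on 625-site frames
(hub-lb-sym-plan-1 RESULT-8/9); `…SyntaxV` (hub-lb-sym-eng-4 / sym-plan-1, V83) re-implements the corner/moves with proved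
equality (`canonTermAV_eq`, `mkSite_minCornerP_eq`).  This module is the 10-line composition asked for on the bus
(sym-plan-1 l.1358 (3)): `canonNFV` + `canonNFV_eq`, `shardOKFastV` + `shardOKFastV_eq`, `ShardFactsFastV` and the closing theorem
`energyDensity_ge_of_shardsFastV` — the MULTI-CALL closing grammar on the executed path.
No summit or crux statement is proved here; no certificate beyond toys is replayed; nothing here predicts superconductivity.
-/

noncomputable section

namespace Summit.Ventures.CertifiedManyBodySolver.Theorems.SymReplay

open Matrix Finset
open Literature.MathematicalPhysics.QuantumLattice
open Literature.MathematicalPhysics.QuantumLattice.HubbardWave0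
open Literature.MathematicalPhysics.QuantumLattice.ThermodynamicLimit
open Literature.Probability.LatticeModels
open Literature.MathematicalPhysics.QuantumManyBody.StateRelaxation
open Summit.Ventures.CertifiedManyBodySolver.Theorems.WardSlot
open scoped ComplexOrder BigOperators

/-- The per-shard pipe on the executed canonicaliser. -/
def canonNFV (frame : List (Site 2)) (p : QPoly) : QPoly :=
  (collect (nfPoly p)).flatMap (canonTermAV (minCornerP frame) frame)

/-- `canonNFV = canonNF`. -/
theorem canonNFV_eq (frame : List (Site 2)) (p : QPoly) : canonNFV frame p = canonNF frame p := by
  unfold canonNFV canonNF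
  rw [canonTermAV_eq, mkSite_minCornerP_eq]

/-- **What ONE farm call proves about shard `j` — executed form** (fast accessor + executed canonicaliser). -/
def shardOKFastV (K : SymCert) (c j : ℕ) (P : QPoly) : Bool :=
  psuppIn P K.frame && isZero (psub (canonNFV K.frame (shardPolyAtFast K c j)) P)

/-- `shardOKFastV = shardOKFast` (`= shardOK`). -/
theorem shardOKFastV_eq (K : SymCert) (c j : ℕ) (P : QPoly) : shardOKFastV K c j P = shardOKFast K c j P := by
  rw [shardOKFastV, shardOKFast, canonNFV_eq]

/-- The per-call facts in executed form (structural on the literal partial list). -/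
def ShardFactsFastV (K : SymCert) (c : ℕ) : ℕ → List QPoly → Prop
  | _, [] => True
  | j, P :: Ps => shardOKFastV K c j P = true ∧ ShardFactsFastV K c (j + 1) Ps

/-- Executed facts give fast facts. -/
theorem shardFactsFast_of_V (K : SymCert) (c : ℕ) :
    ∀ (Ps : List QPoly) (j : ℕ), ShardFactsFastV K c j Ps → ShardFactsFast K c j Ps
  | [], _, _ => trivial
  | P :: Ps, j, h => ⟨(shardOKFastV_eq K c j P) ▸ h.1, shardFactsFast_of_V K c Ps (j + 1) h.2⟩

/-- The final fact in executed form transfers. -/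
theorem isZero_canonNF_of_V (frame : List (Site 2)) (p : QPoly) (h : isZero (canonNFV frame p) = true) :
    isZero (canonNF frame p) = true := by
  rw [← canonNFV_eq]; exact h

/-- **SHARDED REPLAY, EXECUTED CLOSING FORM**: per shard `j < shardCount K c` one module with
`theorem shard_j : shardOKFastV K c j P_j = true := by native_decide`; then `hcount : shardCount K c = m + 1`,
`hfacts : ShardFactsFastV K c 0 [P₀, …, P_m] := ⟨shard_0, …, shard_m, trivial⟩`,
`hfin : isZero (canonNFV K.frame [P₀, …, P_m].flatten) = true` and `hwf : wellFormed K = true` (each one `native_decide`)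
give the window certificate. -/
theorem wardD4CertGe_of_shardsFastV (K : SymCert) (hwf : wellFormed K = true) (c : ℕ) (Ps : List QPoly)
    (hcount : shardCount K c = Ps.length) (hfacts : ShardFactsFastV K c 0 Ps)
    (hfin : isZero (canonNFV K.frame Ps.flatten) = true) : WardD4CertGe ((symValue K : ℚ) : ℝ) :=
  wardD4CertGe_of_shardsFast K hwf c Ps hcount (shardFactsFast_of_V K c Ps 0 hfacts) (isZero_canonNF_of_V _ _ hfin)

/-- … and the energy-density bound `symValue K ≤ e₀(1,0,8,7/8)`. -/
theorem energyDensity_ge_of_shardsFastV (K : SymCert) (hwf : wellFormed K = true) (c : ℕ) (Ps : List QPoly)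
    (hcount : shardCount K c = Ps.length) (hfacts : ShardFactsFastV K c 0 Ps)
    (hfin : isZero (canonNFV K.frame Ps.flatten) = true) :
    ((symValue K : ℚ) : ℝ) ≤ energyDensityTT' 1 0 8 (7 / 8) :=
  energyDensity_ge_of_windowSound_cert _ WardSlot.stub_wardWindowSound
    (wardD4CertGe_of_shardsFastV K hwf c Ps hcount hfacts hfin)

/-- Kernel regression (toy, executed path): shard 3 of `toyCertM` against its own canonical normal form. -/
example : shardOKFastV toyCertM 0 3 (canonNFV toyCertM.frame (shardPolyAtFast toyCertM 0 3)) = true := by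
  decide +kernel

end Summit.Ventures.CertifiedManyBodySolver.Theorems.SymReplay

end
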